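import Summits.MatrixMultiplication.MatrixMultiplication.Theorems.FidelityWitnessesLinearDefectLawCapFrames
import Summits.MatrixMultiplication.MatrixMultiplication.Theorems.FidelityWitnessesLinearDefectLawTwoIff

/-!
# `FidelityWitnesses.LinearDefectLaw` (stmt-MatrixMultiplication-14039) — capture form, II: the rank-4 rung and the whole `n = 2` law

Support file for item `stmt-MatrixMultiplication-14039` (`LinearDefectLaw`) of route
`MatrixMultiplication/FidelityWitnesses`; notation as in part I (`…LinearDefectLawCapFrames`: `m(e_s)`, `cap e`).

`TwoIff.lawAtTwo_iff` (p93130) pinned the `n = 2` instance of the law (`M(2,r) ≤ r + 1`, tree: `R̲(⟨2,2,2⟩) = 7`)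
to the three window rungs `SevenEighthsLaw ∧ SixEighthsAtFive ∧ (M(2,4) ≤ 5)`.  With the two-sided dictionary of
part I:

* `rung24_iff_capFour` (registered stub `stub_rung24IffCapFour`): the unfiled rank-4 rung `M(2,4) ≤ 5` is
  EQUIVALENT to `cap e ≤ 5` for orthonormal 4-frames in honest product 4-planes of `ℂ⁴ ⊗ ℂ⁴`, and only the regime
  `dim span m(e) ≥ 3` carries content (`rung24_of_capFour_hard`; `dim ≤ 2` gives `cap ≤ 4`);
* `lawAtTwo_iff_caps` (registered stub `stub_lawAtTwoIffCaps`): the `n = 2` instance of `LinearDefectLaw`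
  (verbatim) is equivalent to ONE uniform capture law — every orthonormal `k`-frame in an honest product `k`-plane
  (`k ≤ 16`) captures at most `k + 1` units of `⟨2,2,2⟩`: `cap e ≤ k + 1`.  Tight at `k = 5` (Bini, border),
  `k = 6` (`⟨2,2,2⟩ − e`), `k = 7` (Strassen, `W ⊆ E`, `cap = 8`); proved for `k ≤ 3` (`…ThreeDeficient`) and
  `k ≥ 7` (`cap_le_eight`); open exactly at `k = 4, 5, 6` (= this rung, `SixEighthsAtFive`, `SevenEighthsLaw`).
  Equivalently (`cap e = 2 tr(P_E Π_W)`): `tr(P_E (2Π_W − 1)) ≤ 1` for every product-spanned `E ⊆ ℂ⁴ ⊗ ℂ⁴` — the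
  reflection `2Π_W − 1 = m*m − 1` (signature `(4,12)`) has compression trace `≤ 1` on product-spanned planes;
* `lawAtTwo_iff_rungs_capFour`, `capFour_of_linearDefectLaw`: the item implies `cap₄ ≤ 5`.

Numerics (this seat; pure-python projected ascent over product 4-planes + explicit limit planes, evidence file
`Rung24-capform.md` on the item): `max cap₄ = 3 + √2 = 4.41421…`, approached along TWO distinct border families —
(i) the `fourS` family of `…Rung24Border`, whose limit plane has the orthonormal basis
`a₁₁b₀₀, a₁₁(b₁₀+b₁₁)/√2, (√2·a₀₁b₀₀ + a₁₁(b₁₀−b₁₁))/2, (√2·a₀₀b₀₀ + a₁₀(b₁₀+b₁₁))/2` and principal cosines²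
with `W` equal to `cos² 7.5°, cos² 22.5°, cos² 52.5°, 0`; (ii) a zero-sum family (four products becoming linearly
dependent, smallest Gram eigenvalue `→ 0`) with principal cosines² `(6+√2)/8, (2+√2)/8 (×3)`.  So the rank-4 rung
has slack `5 − (3+√2) = 0.586`, while interior critical values found are `4.000` and `4.135`.
-/

noncomputable section

namespace Summit.MatrixMultiplication.MatrixMultiplication.Theorems.LinearDefectLaw.Caps

open scoped BigOperators ComplexConjugate
open Literature.Computability.AlgebraicComplexity
open Summit.MatrixMultiplication.MatrixMultiplication.Theses.FidelityWitnesses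
  (SevenEighthsLaw SixEighthsAtFive)

set_option linter.dupNamespace false

/-! ## The rank-4 rung in capture form -/

/-- **The rank-4 rung from its hard regime.**  If every orthonormal 4-frame `e` in an honest product 4-plane
whose multiplied vectors span at least `3` dimensions (`dim (E ∩ ker m) ≤ 1`) has `cap e ≤ 5`, then
`M(2,4) ≤ 5`; the regime `dim span m(e) ≤ 2` is free (`cap e ≤ 4`, `cap_le_two_mul_finrank`). [folklore] -/
theorem rung24_of_capFour_hard
    (hhard : ∀ (u v : Fin 4 → (Fin 2 × Fin 2) → ℂ)
      (e : Fin 4 → (Fin 2 × Fin 2) → (Fin 2 × Fin 2) → ℂ),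
      (∀ s t : Fin 4, (∑ b, ∑ c, conj (e s b c) * e t b c) = if s = t then 1 else 0) →
      (∀ s, e s ∈ Submodule.span ℂ (Set.range fun l : Fin 4 => fun b c => u l b * v l c)) →
      2 < Module.finrank ℂ (Submodule.span ℂ (Set.range fun s : Fin 4 =>
        fun a : Fin 2 × Fin 2 => ∑ μ : Fin 2, e s (a.1, μ) (μ, a.2))) →
      ∑ s, ∑ a : Fin 2 × Fin 2, ‖∑ m : Fin 2, e s (a.1, m) (m, a.2)‖ ^ 2 ≤ 5) :
    ∀ S : (Fin 2 × Fin 2) → (Fin 2 × Fin 2) → (Fin 2 × Fin 2) → ℂ, tensorRank S ≤ 4 →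
      ‖∑ a, ∑ b, ∑ c, S a b c * matMulTensor ℂ 2 2 2 a b c‖ ^ 2 ≤ 5 * ∑ a, ∑ b, ∑ c, ‖S a b c‖ ^ 2 := by
  refine rung_of_cap (by norm_num) fun u v e he hps => ?_
  by_cases hdim : Module.finrank ℂ (Submodule.span ℂ (Set.range fun s : Fin 4 =>
      fun a : Fin 2 × Fin 2 => ∑ μ : Fin 2, e s (a.1, μ) (μ, a.2))) ≤ 2
  · have h := cap_le_two_mul_finrank e he
    have h2 : (Module.finrank ℂ (Submodule.span ℂ (Set.range fun s : Fin 4 =>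
        fun a : Fin 2 × Fin 2 => ∑ μ : Fin 2, e s (a.1, μ) (μ, a.2))) : ℝ) ≤ 2 := by
      exact_mod_cast hdim
    linarith
  · exact hhard u v e he hps (not_le.mp hdim)

/-- **`M(2,4) ≤ 5` ↔ `cap₄ ≤ 5`.**  The unfiled rank-4 rung of `LinearDefectLaw` at `n = 2` is equivalent to the
capture bound `cap e ≤ 5` for orthonormal 4-frames in honest product 4-planes of `ℂ⁴ ⊗ ℂ⁴`
(numerically `max cap₄ = 3 + √2`). [folklore] -/
theorem rung24_iff_capFour :
    (∀ S : (Fin 2 × Fin 2) → (Fin 2 × Fin 2) → (Fin 2 × Fin 2) → ℂ, tensorRank S ≤ 4 →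
      ‖∑ a, ∑ b, ∑ c, S a b c * matMulTensor ℂ 2 2 2 a b c‖ ^ 2 ≤ 5 * ∑ a, ∑ b, ∑ c, ‖S a b c‖ ^ 2) ↔
    ∀ (u v : Fin 4 → (Fin 2 × Fin 2) → ℂ) (e : Fin 4 → (Fin 2 × Fin 2) → (Fin 2 × Fin 2) → ℂ),
      (∀ s t : Fin 4, (∑ b, ∑ c, conj (e s b c) * e t b c) = if s = t then 1 else 0) →
      (∀ s, e s ∈ Submodule.span ℂ (Set.range fun l : Fin 4 => fun b c => u l b * v l c)) →
      ∑ s, ∑ a : Fin 2 × Fin 2, ‖∑ m : Fin 2, e s (a.1, m) (m, a.2)‖ ^ 2 ≤ 5 :=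
  rung_iff_cap (by norm_num) (by norm_num)

/-! ## The whole `n = 2` law as one capture law -/

/-- **`LinearDefectLaw` at `n = 2` ↔ the uniform capture law.**  The `n = 2` instance of the item (verbatim,
with the tree value `R̲(⟨2,2,2⟩) = 7` inside) is equivalent to: for every `k ≤ 16`, every orthonormal `k`-frame
`e` in an honest product `k`-plane of `ℂ^{P2} ⊗ ℂ^{P2}` captures at most `k + 1` units of `⟨2,2,2⟩`,
`cap e = Σ_s ‖m(e_s)‖² ≤ k + 1`.  (Ranks `k > 16` are vacuous on both sides: `cap ≤ 8`, Cauchy–Schwarz.)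
Tight at `k = 5, 6, 7`; proved for `k ≤ 3` (`…ThreeDeficient`) and `k ≥ 7` (`cap_le_eight`); open at `k = 4, 5, 6`
= `rung24_iff_capFour`, `SixEighthsAtFive`, `SevenEighthsLaw`. [folklore] -/
theorem lawAtTwo_iff_caps :
    (∀ r : ℕ, ∀ S : Fin 2 × Fin 2 → Fin 2 × Fin 2 → Fin 2 × Fin 2 → ℂ, tensorRank S ≤ r →
      ‖∑ a, ∑ b, ∑ c, S a b c * matMulTensor ℂ 2 2 2 a b c‖ ^ 2 ≤
        (((2 : ℕ) : ℝ) ^ 3 + (r : ℝ) - (algBorderRank (matMulTensor ℂ 2 2 2) : ℝ)) *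
          ∑ a, ∑ b, ∑ c, ‖S a b c‖ ^ 2) ↔
    ∀ k : ℕ, k ≤ 16 → ∀ (u v : Fin k → (Fin 2 × Fin 2) → ℂ)
      (e : Fin k → (Fin 2 × Fin 2) → (Fin 2 × Fin 2) → ℂ),
      (∀ s t : Fin k, (∑ b, ∑ c, conj (e s b c) * e t b c) = if s = t then 1 else 0) →
      (∀ s, e s ∈ Submodule.span ℂ (Set.range fun l : Fin k => fun b c => u l b * v l c)) →
      ∑ s, ∑ a : Fin 2 × Fin 2, ‖∑ m : Fin 2, e s (a.1, m) (m, a.2)‖ ^ 2 ≤ (k : ℝ) + 1 := by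
  rw [TwoIff.lawAtTwo_iff_succ]
  constructor
  · intro h k hk u v e he hspan
    exact cap_le_of_rung (by positivity) (fun S hS => h k S hS) u v e he hspan
  · intro h r S hS
    rcases Nat.lt_or_ge r 17 with hr | hr
    · exact rung_of_cap (by omega) (h r (by omega)) S hS
    · -- `r ≥ 17`: Cauchy–Schwarz `8 ≤ r + 1`
      have h8 := Reduction.eight_bounds_two r S hS
      have hr' : (8 : ℝ) ≤ (r : ℝ) + 1 := by
        have : (17 : ℝ) ≤ (r : ℝ) := by exact_mod_cast hr
        linarith
      exact h8.trans (mul_le_mul_of_nonneg_right hr' (Reduction.normSq_nonneg S))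

/-- **What is left of the item at `n = 2`, in capture form.**  The `n = 2` instance of `LinearDefectLaw` is
equivalent to `SevenEighthsLaw ∧ SixEighthsAtFive ∧ (cap e ≤ 5 on honest product 4-planes)`
(`TwoIff.lawAtTwo_iff` + `rung24_iff_capFour`). [folklore] -/
theorem lawAtTwo_iff_rungs_capFour :
    (∀ r : ℕ, ∀ S : Fin 2 × Fin 2 → Fin 2 × Fin 2 → Fin 2 × Fin 2 → ℂ, tensorRank S ≤ r →
      ‖∑ a, ∑ b, ∑ c, S a b c * matMulTensor ℂ 2 2 2 a b c‖ ^ 2 ≤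
        (((2 : ℕ) : ℝ) ^ 3 + (r : ℝ) - (algBorderRank (matMulTensor ℂ 2 2 2) : ℝ)) *
          ∑ a, ∑ b, ∑ c, ‖S a b c‖ ^ 2) ↔
    SevenEighthsLaw ∧ SixEighthsAtFive ∧
      ∀ (u v : Fin 4 → (Fin 2 × Fin 2) → ℂ) (e : Fin 4 → (Fin 2 × Fin 2) → (Fin 2 × Fin 2) → ℂ),
        (∀ s t : Fin 4, (∑ b, ∑ c, conj (e s b c) * e t b c) = if s = t then 1 else 0) →
        (∀ s, e s ∈ Submodule.span ℂ (Set.range fun l : Fin 4 => fun b c => u l b * v l c)) →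
        ∑ s, ∑ a : Fin 2 × Fin 2, ‖∑ m : Fin 2, e s (a.1, m) (m, a.2)‖ ^ 2 ≤ 5 := by
  rw [TwoIff.lawAtTwo_iff, rung24_iff_capFour]

/-- **Corollary for the item.** `LinearDefectLaw` implies the rank-4 capture bound `cap₄ ≤ 5`
(so a product 4-plane with `cap e > 5` — none is expected: `max = 3 + √2` numerically — would refute the item
in one line). -/
theorem capFour_of_linearDefectLaw
    (h : Summit.MatrixMultiplication.MatrixMultiplication.Theses.FidelityWitnesses.LinearDefectLaw)
    (u v : Fin 4 → (Fin 2 × Fin 2) → ℂ) (e : Fin 4 → (Fin 2 × Fin 2) → (Fin 2 × Fin 2) → ℂ)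
    (he : ∀ s t : Fin 4, (∑ b, ∑ c, conj (e s b c) * e t b c) = if s = t then 1 else 0)
    (hspan : ∀ s, e s ∈ Submodule.span ℂ (Set.range fun l : Fin 4 => fun b c => u l b * v l c)) :
    ∑ s, ∑ a : Fin 2 × Fin 2, ‖∑ m : Fin 2, e s (a.1, m) (m, a.2)‖ ^ 2 ≤ 5 :=
  (lawAtTwo_iff_rungs_capFour.1 fun r S hS => h 2 r S hS).2.2 u v e he hspan

/-! ## Registered stubs (raw forms) -/

/-- **Registered stub `stub_lawAtTwoIffCaps`** (raw form of `lawAtTwo_iff_caps`): the `n = 2` instance of the item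
is the uniform capture law `cap e ≤ k + 1` on honest product `k`-planes, `k ≤ 16`. -/
theorem stub_lawAtTwoIffCaps : (∀ r : ℕ, ∀ S : Fin 2 × Fin 2 → Fin 2 × Fin 2 → Fin 2 × Fin 2 → ℂ, tensorRank S ≤ r → ‖∑ a, ∑ b, ∑ c, S a b c * matMulTensor ℂ 2 2 2 a b c‖ ^ 2 ≤ (((2 : ℕ) : ℝ) ^ 3 + (r : ℝ) - (algBorderRank (matMulTensor ℂ 2 2 2) : ℝ)) * ∑ a, ∑ b, ∑ c, ‖S a b c‖ ^ 2) ↔ ∀ k : ℕ, k ≤ 16 → ∀ (u v : Fin k → (Fin 2 × Fin 2) → ℂ) (e : Fin k → (Fin 2 × Fin 2) → (Fin 2 × Fin 2) → ℂ), (∀ s t : Fin k, (∑ b, ∑ c, (starRingEnd ℂ) (e s b c) * e t b c) = if s = t then 1 else 0) → (∀ s, e s ∈ Submodule.span ℂ (Set.range fun l : Fin k => fun b c => u l b * v l c)) → ∑ s, ∑ a : Fin 2 × Fin 2, ‖∑ m : Fin 2, e s (a.1, m) (m, a.2)‖ ^ 2 ≤ (k : ℝ) + 1 :=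
  lawAtTwo_iff_caps

/-- **Registered stub `stub_rung24IffCapFour`** (raw form of `rung24_iff_capFour`): the rank-4 rung `M(2,4) ≤ 5`
is the capture bound `cap e ≤ 5` on honest product 4-planes. -/
theorem stub_rung24IffCapFour : (∀ S : (Fin 2 × Fin 2) → (Fin 2 × Fin 2) → (Fin 2 × Fin 2) → ℂ, tensorRank S ≤ 4 → ‖∑ a, ∑ b, ∑ c, S a b c * matMulTensor ℂ 2 2 2 a b c‖ ^ 2 ≤ 5 * ∑ a, ∑ b, ∑ c, ‖S a b c‖ ^ 2) ↔ ∀ (u v : Fin 4 → (Fin 2 × Fin 2) → ℂ) (e : Fin 4 → (Fin 2 × Fin 2) → (Fin 2 × Fin 2) → ℂ), (∀ s t : Fin 4, (∑ b, ∑ c, (starRingEnd ℂ) (e s b c) * e t b c) = if s = t then 1 else 0) → (∀ s, e s ∈ Submodule.span ℂ (Set.range fun l : Fin 4 => fun b c => u l b * v l c)) → ∑ s, ∑ a : Fin 2 × Fin 2, ‖∑ m : Fin 2, e s (a.1, m) (m, a.2)‖ ^ 2 ≤ 5 :=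
  rung24_iff_capFour

end Summit.MatrixMultiplication.MatrixMultiplication.Theorems.LinearDefectLaw.Caps

end
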